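import Mathlib
import Summits.ValiantsHypothesis.ValiantsHypothesis.Theorems.NewtonUnitEquationsNewtonTauWeakExactCoverShadow
import Summits.ValiantsHypothesis.ValiantsHypothesis.Theorems.NewtonUnitEquationsNewtonTauWeakThreeCoreExposed

/-!
# `NewtonUnitEquationsNewtonTauWeakCoreDesignKillSwitch` — T2 bounds the strictly positively exposed points of
# every `c`-core design (the design-language kill switch)

Line `binomial-normal-form` of crux `NewtonTauWeak` (stmt-ValiantsHypothesis-5904), lead c7, stub P14
(`stub_coreDesignKillSwitch`, the registered text verbatim).

`T2(b)` is the open registered stub `stub_binomialNewtonTauCommon` with a FIXED exponent `b` (hypothesis `hT2`):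
every sum of `K` scalar multiples of products of `N` binomials `1 − ρ_{lj} X^{d_j}` over a common exponent list has
`≤ (K N + 2)^b` Newton vertices.  A design on `c` cores is `h : Fin c → Finset (Fin x) → ℕ²` (costs written
`Fin 2 →₀ ℕ`); the configuration `f : Fin x → Fin c` (attached element `u` joins core `f u`) has the point
`P f = Σ_d h d (f⁻¹ d)`.  The cloud `{P f}` IS an exact-cover cloud: the block family `{core d} ∪ S`
(`d ∈ Fin c`, `S ⊆ Fin x`) has `N = c · 2^x` items (through a bijection `e : Fin (c · 2^x) ≃ Fin c × Finset (Fin x)`)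
on `r = x + c` coordinates (`Fin (x + c) = Fin x ⊕ Fin c`: attached `Fin.castAdd c u`, core `Fin.natAdd x d`);
the item `(d, S)` is labelled by the indicator of `S ∪ {core d}` (a `Fin.append`) and costs `h d S`.

* Exact covers (every coordinate covered by exactly one chosen item) are exactly the families
  `{(d, f⁻¹ d) : d ∈ Fin c}`: the item covering core `d` is unique and every item covers its own core
  (`eq_family_of_cover`), and the attached coordinates are covered once iff the sets `S d` partition `Fin x`
  (`cover_family_iff`), i.e. iff they are the level sets of some `f : Fin x → Fin c`
  (`exists_levelSets_of_partition`, `levelSets_partition`); the point of this cover is `P f` (`sum_family`).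
  Hence the points of exact covers are exactly the design points (`cover_point_iff`).
* Consequently the set of strictly positively exposed design points (strict minimisers, among the design points,
  of some `w₀ x₀ + w₁ x₁` with `w₀, w₁ > 0`) IS the set of strictly positively exposed exact-cover points
  (`coreDesign_set_eq`), which `exactCoverShadow_of_T2` bounds by `(2^r N + 2)^b = (2^{x+c} · (c · 2^x) + 2)^b`.

The argument is uniform in `c` and `x` (for `c = 0 < x` both sets are empty; for `c = x = 0` both are `{0}`).
Main result: `stub_coreDesignKillSwitch` (registered signature).  Helpers in the sub-namespace
`CoreDesignKillSwitchAux` generalise `ThreeCoreExposedAux` (`Fin 3 ↦ Fin c`, abstract `e : ι ≃ Fin c × Finset (Fin x)`);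
Mathlib and the two imported tree files only; no definitions, no named facts, no citations; everything is
[folklore].
-/

-- Sub = Summit single-conjunct layout: the duplicated namespace component is mandated by the tree.
set_option linter.dupNamespace false

open scoped BigOperators
open MvPolynomial
open Summit.ValiantsHypothesis.ValiantsHypothesis.Theorems.NewtonTauWeak.Negative (vert)

namespace Summit.ValiantsHypothesis.ValiantsHypothesis.Theorems.NewtonUnitEquationsNewtonTauWeak

namespace CoreDesignKillSwitchAux

open Finset

section Cover

variable {x c : ℕ} {ι : Type*} (e : ι ≃ Fin c × Finset (Fin x))

/-- The items `(i, S i)`, `i ∈ Fin c`, of a family indexed by the cores are distinct. [folklore] -/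
theorem family_injective (S : Fin c → Finset (Fin x)) :
    Function.Injective fun i : Fin c => e.symm (i, S i) := fun i i' hii' => by
  simpa using congrArg (fun j => (e j).1) hii'

variable [DecidableEq ι]

/-- Counting inside the family `{(i, S i)}`. [folklore] -/
theorem card_filter_family (S : Fin c → Finset (Fin x)) (p : ι → Prop) [DecidablePred p] :
    ((univ.image fun i => e.symm (i, S i)).filter p).card =
      (univ.filter fun i => p (e.symm (i, S i))).card := by
  rw [Finset.filter_image, Finset.card_image_of_injective _ (family_injective e S)]

/-- Summing a design over the family `{(i, S i)}`: the sum is `Σ_i h i (S i)`. [folklore] -/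
theorem sum_family {A : Type*} [AddCommMonoid A] (S : Fin c → Finset (Fin x))
    (h : Fin c → Finset (Fin x) → A) :
    ∑ j ∈ univ.image (fun i => e.symm (i, S i)), h (e j).1 (e j).2 = ∑ i, h i (S i) := by
  rw [Finset.sum_image fun i _ i' _ hii' => family_injective e S hii']
  simp only [Equiv.apply_symm_apply]

variable (lab : Fin c × Finset (Fin x) → Fin (x + c) → ZMod 2)

/-- An attached coordinate `u` is covered by the family `{(i, S i)}` as many times as there are `i` with
`u ∈ S i`. [folklore] -/
theorem card_filter_family_left (hl : ∀ p u, lab p (Fin.castAdd c u) = 1 ↔ u ∈ p.2)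
    (S : Fin c → Finset (Fin x)) (u : Fin x) :
    ((univ.image fun i => e.symm (i, S i)).filter fun j => lab (e j) (Fin.castAdd c u) = 1).card =
      (univ.filter fun i => u ∈ S i).card := by
  rw [card_filter_family]
  exact congrArg Finset.card (Finset.filter_congr fun i _ => by rw [hl, Equiv.apply_symm_apply])

/-- A core coordinate is covered exactly once by the family `{(i, S i)}`. [folklore] -/
theorem card_filter_family_right (hr : ∀ p i, lab p (Fin.natAdd x i) = 1 ↔ i = p.1)
    (S : Fin c → Finset (Fin x)) (i : Fin c) :
    ((univ.image fun i => e.symm (i, S i)).filter fun j => lab (e j) (Fin.natAdd x i) = 1).card = 1 := by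
  rw [card_filter_family, Finset.card_eq_one]
  refine ⟨i, Finset.ext fun i' => ?_⟩
  simp only [Finset.mem_filter, Finset.mem_univ, true_and, hr, Equiv.apply_symm_apply,
    Finset.mem_singleton]
  exact eq_comm

/-- The family `{(i, S i)}` is an exact cover iff the sets `S i`, `i ∈ Fin c`, partition the attached
coordinates. [folklore] -/
theorem cover_family_iff (hl : ∀ p u, lab p (Fin.castAdd c u) = 1 ↔ u ∈ p.2)
    (hr : ∀ p i, lab p (Fin.natAdd x i) = 1 ↔ i = p.1) (S : Fin c → Finset (Fin x)) :
    (∀ k : Fin (x + c),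
        ((univ.image fun i => e.symm (i, S i)).filter fun j => lab (e j) k = 1).card = 1) ↔
      ∀ u : Fin x, (univ.filter fun i => u ∈ S i).card = 1 := by
  refine ⟨fun hk u => ?_, fun hu k => ?_⟩
  · rw [← card_filter_family_left e lab hl S u]
    exact hk _
  · refine Fin.addCases (fun u => ?_) (fun i => ?_) k
    · rw [card_filter_family_left e lab hl S u]
      exact hu u
    · exact card_filter_family_right e lab hr S i

/-- Every exact cover is one of the families `{(i, S i)}`: the item covering core `i` is unique, and every
item covers its own core. [folklore] -/
theorem eq_family_of_cover (hr : ∀ p i, lab p (Fin.natAdd x i) = 1 ↔ i = p.1) {J : Finset ι}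
    (hJ : ∀ k : Fin (x + c), (J.filter fun j => lab (e j) k = 1).card = 1) :
    ∃ S : Fin c → Finset (Fin x), J = univ.image fun i => e.symm (i, S i) := by
  have h1 : ∀ i : Fin c, ∃ a, (J.filter fun j => lab (e j) (Fin.natAdd x i) = 1) = {a} := fun i =>
    Finset.card_eq_one.mp (hJ _)
  choose sel hsel using h1
  have hmem : ∀ i j, j ∈ J ∧ i = (e j).1 ↔ j = sel i := fun i j => by
    simpa only [Finset.mem_filter, Finset.mem_singleton, hr] using Finset.ext_iff.mp (hsel i) j
  have hsel' : ∀ i, sel i ∈ J ∧ i = (e (sel i)).1 := fun i => (hmem i _).mpr rfl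
  have hsymm : ∀ i, e.symm (i, (e (sel i)).2) = sel i := fun i =>
    e.symm_apply_eq.mpr (Prod.ext (hsel' i).2 rfl)
  refine ⟨fun i => (e (sel i)).2, Finset.ext fun j => ?_⟩
  simp only [Finset.mem_image, Finset.mem_univ, true_and, hsymm]
  exact ⟨fun hj => ⟨(e j).1, ((hmem _ j).mp ⟨hj, rfl⟩).symm⟩, fun ⟨i, hi⟩ => hi ▸ (hsel' i).1⟩

/-- The level sets of `f : Fin x → Fin c` partition `Fin x`. [folklore] -/
theorem levelSets_partition (f : Fin x → Fin c) (u : Fin x) :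
    (univ.filter fun i => u ∈ univ.filter fun v => f v = i).card = 1 := by
  rw [Finset.card_eq_one]
  exact ⟨f u, Finset.ext fun i => by simp [eq_comm]⟩

/-- Sets `S i`, `i ∈ Fin c`, that partition `Fin x` are the level sets of a function `f : Fin x → Fin c`
(`f u` is the unique `i` with `u ∈ S i`). [folklore] -/
theorem exists_levelSets_of_partition (S : Fin c → Finset (Fin x))
    (hS : ∀ u : Fin x, (univ.filter fun i => u ∈ S i).card = 1) :
    ∃ f : Fin x → Fin c, ∀ i, S i = univ.filter fun u => f u = i := by
  have h1 : ∀ u : Fin x, ∃ i, (univ.filter fun i => u ∈ S i) = {i} := fun u =>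
    Finset.card_eq_one.mp (hS u)
  choose f hf using h1
  have hmem : ∀ u i, u ∈ S i ↔ i = f u := fun u i => by
    simpa only [Finset.mem_filter, Finset.mem_univ, true_and, Finset.mem_singleton] using
      Finset.ext_iff.mp (hf u) i
  refine ⟨f, fun i => Finset.ext fun u => ?_⟩
  rw [hmem, Finset.mem_filter]
  exact ⟨fun hu => ⟨Finset.mem_univ _, hu.symm⟩, fun hu => hu.2.symm⟩

/-- **Points of exact covers = design points.**  `q` is the cost `Σ_{j ∈ J} h (e j).1 (e j).2` of an exact cover
`J` iff `q = Σ_d h d (f⁻¹ d)` for some configuration `f : Fin x → Fin c`. [folklore] -/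
theorem cover_point_iff (hl : ∀ p u, lab p (Fin.castAdd c u) = 1 ↔ u ∈ p.2)
    (hr : ∀ p i, lab p (Fin.natAdd x i) = 1 ↔ i = p.1) (h : Fin c → Finset (Fin x) → (Fin 2 →₀ ℕ))
    (q : Fin 2 →₀ ℕ) :
    (∃ J : Finset ι, (∀ k : Fin (x + c), (J.filter fun j => lab (e j) k = 1).card = 1) ∧
        ∑ j ∈ J, h (e j).1 (e j).2 = q) ↔
      ∃ f : Fin x → Fin c, ∑ d, h d (Finset.univ.filter fun u => f u = d) = q := by
  constructor
  · rintro ⟨J, hJ, rfl⟩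
    obtain ⟨S, rfl⟩ := eq_family_of_cover e lab hr hJ
    obtain ⟨f, hf⟩ := exists_levelSets_of_partition S ((cover_family_iff e lab hl hr S).mp hJ)
    refine ⟨f, ?_⟩
    rw [sum_family]
    exact Finset.sum_congr rfl fun i _ => (congrArg (h i) (hf i)).symm
  · rintro ⟨f, rfl⟩
    exact ⟨univ.image fun i => e.symm (i, Finset.univ.filter fun u => f u = i),
      (cover_family_iff e lab hl hr fun i => Finset.univ.filter fun u => f u = i).mpr
        (levelSets_partition f),
      sum_family e (fun i => Finset.univ.filter fun u => f u = i) h⟩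

/-- **The exposed sets coincide.**  The strictly positively exposed design points (strict minimisers, among all
design points `Σ_d h d (f⁻¹ d)`, of some `w₀ x₀ + w₁ x₁` with `w₀, w₁ > 0`) are exactly the strictly positively
exposed exact-cover points of the block family (same points by `cover_point_iff`, and the strictness clauses
quantify over the same set of competitors). [folklore] -/
theorem coreDesign_set_eq (hl : ∀ p u, lab p (Fin.castAdd c u) = 1 ↔ u ∈ p.2)
    (hr : ∀ p i, lab p (Fin.natAdd x i) = 1 ↔ i = p.1) (h : Fin c → Finset (Fin x) → (Fin 2 →₀ ℕ)) :
    {q : Fin 2 →₀ ℕ | (∃ f : Fin x → Fin c, ∑ d, h d (Finset.univ.filter fun u => f u = d) = q ∧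
          ∃ w : Fin 2 → ℝ, 0 < w 0 ∧ 0 < w 1 ∧ ∀ f' : Fin x → Fin c,
            ∑ d, h d (Finset.univ.filter fun u => f' u = d) ≠ q →
            w 0 * ((q 0 : ℕ) : ℝ) + w 1 * ((q 1 : ℕ) : ℝ) <
              w 0 * (((∑ d, h d (Finset.univ.filter fun u => f' u = d)) 0 : ℕ) : ℝ) +
                w 1 * (((∑ d, h d (Finset.univ.filter fun u => f' u = d)) 1 : ℕ) : ℝ))} =
      {q : Fin 2 →₀ ℕ | ∃ J : Finset ι, (∀ i : Fin (x + c), (J.filter fun j => lab (e j) i = 1).card = 1) ∧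
        ∑ j ∈ J, h (e j).1 (e j).2 = q ∧ ∃ w : Fin 2 → ℝ, 0 < w 0 ∧ 0 < w 1 ∧
        ∀ J' : Finset ι, (∀ i : Fin (x + c), (J'.filter fun j => lab (e j) i = 1).card = 1) →
          ∑ j ∈ J', h (e j).1 (e j).2 ≠ q →
          w 0 * ((q 0 : ℕ) : ℝ) + w 1 * ((q 1 : ℕ) : ℝ) <
            w 0 * (((∑ j ∈ J', h (e j).1 (e j).2) 0 : ℕ) : ℝ) +
              w 1 * (((∑ j ∈ J', h (e j).1 (e j).2) 1 : ℕ) : ℝ)} := by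
  ext q
  simp only [Set.mem_setOf_eq]
  constructor
  · rintro ⟨f, hq, w, hw0, hw1, hmin⟩
    obtain ⟨J, hJ, hJq⟩ := (cover_point_iff e lab hl hr h q).mpr ⟨f, hq⟩
    refine ⟨J, hJ, hJq, w, hw0, hw1, fun J' hJ' hne => ?_⟩
    obtain ⟨f', hf'⟩ := (cover_point_iff e lab hl hr h _).mp ⟨J', hJ', rfl⟩
    rw [← hf'] at hne ⊢
    exact hmin f' hne
  · rintro ⟨J, hJ, hq, w, hw0, hw1, hmin⟩
    obtain ⟨f, hf⟩ := (cover_point_iff e lab hl hr h q).mp ⟨J, hJ, hq⟩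
    refine ⟨f, hf, w, hw0, hw1, fun f' hne => ?_⟩
    obtain ⟨J', hJ', hJ'q⟩ := (cover_point_iff e lab hl hr h _).mpr ⟨f', rfl⟩
    rw [← hJ'q] at hne ⊢
    exact hmin J' hJ' hne

end Cover

end CoreDesignKillSwitchAux

/-- **STUB P14 `stub_coreDesignKillSwitch`** (registered signature, verbatim) — the design-language kill switch.
If the open stub T2 holds with exponent `b` (hypothesis `hT2`), then for every `c`-core design
`h : Fin c → Finset (Fin x) → ℕ²` the design points `Σ_d h d (f⁻¹ d)`, `f : Fin x → Fin c`, that are strict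
minimisers among all design points of some `w₀ x₀ + w₁ x₁` with `w₀, w₁ > 0` number at most
`(2^{x+c} · (c · 2^x) + 2)^b`.  Proof: the design cloud is the exact-cover cloud of the block family
`{core d} ∪ S` (`N = c · 2^x` items on `r = x + c` coordinates, `CoreDesignKillSwitchAux.coreDesign_set_eq`),
bounded by `exactCoverShadow_of_T2` with `2^r N + 2 = 2^{x+c} · (c · 2^x) + 2`. [folklore] -/
theorem stub_coreDesignKillSwitch (b : ℕ)
    (hT2 : ∀ (K N : ℕ) (c : Fin K → ℂ) (ρ : Fin K → Fin N → ℂ) (d : Fin N → (Fin 2 →₀ ℕ)),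
      vert (∑ l, C (c l) * ∏ j, (1 - C (ρ l j) * monomial (d j) 1)) ≤ (K * N + 2) ^ b)
    (c x : ℕ) (h : Fin c → Finset (Fin x) → (Fin 2 →₀ ℕ)) :
    {q : Fin 2 →₀ ℕ | (∃ f : Fin x → Fin c, ∑ d, h d (Finset.univ.filter fun u => f u = d) = q ∧
          ∃ w : Fin 2 → ℝ, 0 < w 0 ∧ 0 < w 1 ∧ ∀ f' : Fin x → Fin c,
            ∑ d, h d (Finset.univ.filter fun u => f' u = d) ≠ q →
            w 0 * ((q 0 : ℕ) : ℝ) + w 1 * ((q 1 : ℕ) : ℝ) <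
              w 0 * (((∑ d, h d (Finset.univ.filter fun u => f' u = d)) 0 : ℕ) : ℝ) +
                w 1 * (((∑ d, h d (Finset.univ.filter fun u => f' u = d)) 1 : ℕ) : ℝ))}.ncard ≤
      (2 ^ (x + c) * (c * 2 ^ x) + 2) ^ b := by
  -- the items: cores × attached sets, enumerated by `Fin (c * 2 ^ x)`
  obtain ⟨e⟩ : Nonempty (Fin (c * 2 ^ x) ≃ Fin c × Finset (Fin x)) :=
    ⟨(Fintype.equivFinOfCardEq (by simp)).symm⟩
  -- the labels: the indicator of `S ∪ {core d}` on `Fin (x + c) = Fin x ⊕ Fin c`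
  obtain ⟨lab, hl, hr⟩ : ∃ lab : Fin c × Finset (Fin x) → Fin (x + c) → ZMod 2,
      (∀ p u, lab p (Fin.castAdd c u) = 1 ↔ u ∈ p.2) ∧ ∀ p i, lab p (Fin.natAdd x i) = 1 ↔ i = p.1 :=
    ⟨fun p => Fin.append (fun u : Fin x => if u ∈ p.2 then (1 : ZMod 2) else 0)
        (fun i : Fin c => if i = p.1 then (1 : ZMod 2) else 0),
      fun p u => by simp only [Fin.append_left]; exact Ne.ite_eq_left_iff one_ne_zero,
      fun p i => by simp only [Fin.append_right]; exact Ne.ite_eq_left_iff one_ne_zero⟩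
  -- the design cloud is the exact-cover cloud; apply the exact-cover shadow bound
  exact (congrArg Set.ncard (CoreDesignKillSwitchAux.coreDesign_set_eq e lab hl hr h)).trans_le
    (exactCoverShadow_of_T2 b hT2 (c * 2 ^ x) (x + c) (fun j => lab (e j)) fun j => h (e j).1 (e j).2)

end Summit.ValiantsHypothesis.ValiantsHypothesis.Theorems.NewtonUnitEquationsNewtonTauWeak
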